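import Summits.FinalStateConjecture.FinalStateConjecture.Theorems.BulkKerrCaptureC2.Negative.BlockForm
import Summits.FinalStateConjecture.FinalStateConjecture.Theorems.BulkKerrCapture.Negative.LineStubs
import HarnessLib

/-!
# `BulkKerrCaptureC2` — load-bearing hypotheses and kill templates

Sequel of `…/Theorems/BulkKerrCaptureC2/Negative/BlockForm.lean` (block form `CaptureC2At`, prefix
structure, centre lemmas, degenerate centres) for the crux `stmt-FinalStateConjecture-14985`
(`Summit.FinalStateConjecture.FinalStateConjecture.Theses.PhaseMixingCapture.BulkKerrCaptureC2`),
standing disprover, cycle 1, 2026-08-16. Nothing here asserts the crux.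

## Contents

* §5 load-bearing hypotheses, as conditional refutations of the two one-hypothesis weakenings of
  the crux (`CaptureC2Family T P`, the crux being the member `T = Iio 1`, `P = (0 < ·)`,
  `bulkKerrCaptureC2_iff_family`): a threshold `a₁ > 1` is refuted modulo Choquet-Bruhat–Geroch and
  the constraints of one super-extremal Kerr datum (`captureC2Family_false_of_one_lt`); the
  BOUNDARY threshold `a₁ = 1` and the massless member `P 0` are refuted only modulo, in addition,
  Kerr-limit rigidity IN `C²` (`BulkKerrCapture.Negative.KerrLimitRigidity 2`, the order at which
  rigidity is a curvature statement): `captureC2Family_false_of_one_le_of_rigidity`,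
  `captureC2Family_false_of_mass_zero_of_rigidity`. So any proof of the crux must use the strict
  spin gap `a₁ < 1` and the positive mass `0 < M` — but, unlike for the predecessor crux
  `BulkKerrCapture` (`BulkKerrCapture.Negative.strengthenings_fail`, pinning by the modulus), under
  the `∀ η ∃ ε` typing this is visible only through limit rigidity, except above the boundary
  (`a₁ > 1`) where counting suffices.
* §6 kill templates (the honest shape of any refutation of the crux itself):
  `not_bulkKerrCaptureC2_of_kerrData_mghd`, `not_bulkKerrCaptureC2_of_schwarzschild_mghd`,
  `not_bulkKerrCaptureC2_iff`; and `bulkKerrCaptureC2_pointwise` (the crux implies the pointwise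
  `k = 2` claim shape at the unit leaf: its only content beyond that is local uniformity in the spin).
-/

-- the doubled `FinalStateConjecture.FinalStateConjecture` path component trips dupNamespace
set_option linter.dupNamespace false

noncomputable section

open Set Filter Topology Function
open scoped Manifold ContDiff ENNReal Topology
open Literature.Geometry.Lorentzian
open Summit.FinalStateConjecture.FinalStateConjecture.Theses.PhaseMixingCapture (BulkKerrCaptureC2)
open Summit.FinalStateConjecture.FinalStateConjecture.Theorems.BulkKerrCapture

namespace Summit.FinalStateConjecture.FinalStateConjecture.Theorems.BulkKerrCaptureC2.Negative

/-! ## §5 Load-bearing hypotheses: the two one-hypothesis weakenings -/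

/-- **The crux family with its two side conditions exposed**: thresholds `a₁` range over `T ⊆ ℝ`
and masses over `{M | 0 ≤ M ∧ P M}`; everything else verbatim (`CaptureC2At`). The crux is the
member `T = Iio 1`, `P = (0 < ·)` (`bulkKerrCaptureC2_iff_family`). A parametrised predicate, not a
named fact. [folklore] -/
def CaptureC2Family [Kerr.Facts] [Kerr.SliceFacts] (T : Set ℝ) (P : ℝ → Prop) : Prop :=
  ∀ a₁ ∈ T, ∃ (s : ℕ) (δ : ℝ), ∀ (M : ℝ) (hM : 0 ≤ M), P M → ∀ η > (0 : ℝ), ∃ ε > (0 : ℝ),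
    ∀ a : ℝ, |a| ≤ a₁ * M → CaptureC2At s δ M hM ε η a

/-- The family is antitone in the threshold set and in the mass predicate. [folklore] -/
theorem CaptureC2Family.anti [Kerr.Facts] [Kerr.SliceFacts] {T T' : Set ℝ} {P P' : ℝ → Prop}
    (h : CaptureC2Family T P) (hT : T' ⊆ T) (hP : ∀ M, P' M → P M) :
    CaptureC2Family T' P' := fun a₁ ha₁ ↦ by
  obtain ⟨s, δ, hsδ⟩ := h a₁ (hT ha₁)
  exact ⟨s, δ, fun M hM hPM ↦ hsδ M hM (hP M hPM)⟩

/-- **The crux is the member `T = Iio 1`, `P = (0 < ·)`.** [folklore] -/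
theorem bulkKerrCaptureC2_iff_family :
    BulkKerrCaptureC2 ↔ ∀ [Kerr.Facts] [Kerr.SliceFacts], CaptureC2Family (Iio 1) (0 < ·) := by
  rw [bulkKerrCaptureC2_iff_captureC2At]
  constructor
  · intro h _ _ a₁ ha₁
    obtain ⟨s, δ, hsδ⟩ := h a₁ ha₁
    exact ⟨s, δ, fun M _ hM ↦ hsδ M hM⟩
  · intro h _ _ a₁ ha₁
    obtain ⟨s, δ, hsδ⟩ := h a₁ ha₁
    exact ⟨s, δ, fun M hM ↦ hsδ M hM.le hM⟩

/-- Every member below the crux is implied by it. [folklore] -/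
theorem captureC2Family_of_bulkKerrCaptureC2 (h : BulkKerrCaptureC2) [Kerr.Facts]
    [Kerr.SliceFacts] {T : Set ℝ} {P : ℝ → Prop} (hT : T ⊆ Iio 1) (hP : ∀ M, P M → 0 < M) :
    CaptureC2Family T P :=
  (bulkKerrCaptureC2_iff_family.1 h).anti hT hP

/-- Members whose spin range is empty at every admitted mass hold vacuously (e.g. `T ⊆ Iio 0`
with `P ⊆ (0 < ·)`, or `P = ⊥`). [folklore] -/
theorem captureC2Family_of_vacuous [Kerr.Facts] [Kerr.SliceFacts] {T : Set ℝ} {P : ℝ → Prop}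
    (h : ∀ a₁ ∈ T, ∀ M : ℝ, 0 ≤ M → P M → ∀ a : ℝ, ¬ |a| ≤ a₁ * M) : CaptureC2Family T P :=
  fun a₁ ha₁ ↦ ⟨0, 0, fun M hM hPM _ _ ↦ ⟨1, one_pos, fun a ha ↦ (h a₁ ha₁ M hM hPM a ha).elim⟩⟩

/-- An MGHD of a Kerr datum from its constraint fact and Choquet-Bruhat–Geroch (re-export of
`BulkKerrCapture.Negative.exists_mghd_kerrData_of` at the leaf `r₀ = M`).
[cite: ChoquetBruhatGeroch1969CMP, Thm. 3 (p. 332)] -/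
theorem exists_mghd [Kerr.Facts] [Kerr.SliceFacts] {M a : ℝ}
    (hvac : Kerr.data_isVacuumConstraintSolution M a M)
    (hMGHD : choquetBruhat_geroch_exists_mghd_cauchy) (hM : 0 ≤ M) :
    ∃ 𝒟 : VacuumCauchyDevelopment (Kerr.data M a M hM), 𝒟.IsMaximal :=
  Negative.exists_mghd_kerrData_of hvac hMGHD hM

/-- **(A⁺) A threshold above `1` is refuted by counting.** Every member whose threshold set reaches
some `a₁ > 1` and whose mass predicate admits some `M > 0` is FALSE modulo Choquet-Bruhat–Geroch and
the constraints of the SUPER-extremal Kerr datum `Kerr.data M (a₁M) M` (`hvac`, named fact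
`Kerr.data_isVacuumConstraintSolution`; unproved in the tree for `a ≠ 0`): at that centre
(distance `0`) the member predicts, for `η := (a₁ − 1)M/2`, a sub-extremal `(M', a')` within `η` of
`(M, a₁M)`, and there is none (`not_exists_subextremal_near_of_lt`). [folklore] -/
theorem captureC2Family_false_of_one_lt [Kerr.Facts] [Kerr.SliceFacts] {T : Set ℝ}
    {P : ℝ → Prop} (hT : ∃ a₁ ∈ T, 1 < a₁) (hP : ∃ M, 0 < M ∧ P M)
    (hvac : ∀ M a : ℝ, Kerr.data_isVacuumConstraintSolution M a M)
    (hMGHD : choquetBruhat_geroch_exists_mghd_cauchy) : ¬ CaptureC2Family T P := by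
  intro h
  obtain ⟨a₁, ha₁T, ha₁⟩ := hT
  obtain ⟨M, hM, hPM⟩ := hP
  obtain ⟨s, δ, hsδ⟩ := h a₁ ha₁T
  set η : ℝ := (a₁ - 1) * M / 2 with hη_def
  have hη : 0 < η := by
    rw [hη_def]
    exact div_pos (mul_pos (by linarith) hM) two_pos
  obtain ⟨ε, hε, hcap⟩ := hsδ M hM.le hPM η hη
  have hspin : |a₁ * M| ≤ a₁ * M := (abs_of_pos (mul_pos (by linarith) hM)).le
  obtain ⟨𝒟, hmax⟩ := exists_mghd (hvac M (a₁ * M)) hMGHD hM.le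
  obtain ⟨-, M', a', -, hsub, -, hpar⟩ := captureC2At_atKerrData hε (hcap _ hspin) (hvac M _) 𝒟 hmax
  refine not_exists_subextremal_near_of_lt ?_ ⟨M', a', hsub, hpar⟩
  rw [abs_of_pos (mul_pos (by linarith) hM), hη_def]
  nlinarith

/-- **(A) The boundary threshold `a₁ = 1` is refuted only modulo `C²` Kerr-limit rigidity.** Every
member whose threshold set reaches some `a₁ ≥ 1` and whose mass predicate admits some `M > 0` is
FALSE modulo Choquet-Bruhat–Geroch, the constraints of the extremal datum `Kerr.data M M M`, and
Kerr-limit rigidity in `C²` at that datum (`BulkKerrCapture.Negative.KerrLimitRigidity 2 M _ M`: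
a `C²`-limit `g_{M',a'}` of an MGHD of the datum has `M' = M`, `|a'| = |M|`): the predicted
sub-extremal limit would be extremal. At `k = 2` rigidity is a curvature statement (the deviation
controls `Riem(Ψ^*g) − Riem(g_{M',a'})`); it is true in print and not constructible here.
[folklore] -/
theorem captureC2Family_false_of_one_le_of_rigidity [Kerr.Facts] [Kerr.SliceFacts] {T : Set ℝ}
    {P : ℝ → Prop} (hT : ∃ a₁ ∈ T, 1 ≤ a₁) (hP : ∃ M, 0 < M ∧ P M)
    (hvac : ∀ M : ℝ, Kerr.data_isVacuumConstraintSolution M M M)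
    (hMGHD : choquetBruhat_geroch_exists_mghd_cauchy)
    (hrig : ∀ (M : ℝ) (hM : 0 < M), Negative.KerrLimitRigidity 2 M hM.le M) :
    ¬ CaptureC2Family T P := by
  intro h
  obtain ⟨a₁, ha₁T, ha₁⟩ := hT
  obtain ⟨M, hM, hPM⟩ := hP
  obtain ⟨s, δ, hsδ⟩ := h a₁ ha₁T
  obtain ⟨ε, hε, hcap⟩ := hsδ M hM.le hPM 1 one_pos
  have hspin : |M| ≤ a₁ * M := by
    rw [abs_of_pos hM]
    nlinarith
  obtain ⟨𝒟, hmax⟩ := exists_mghd (hvac M) hMGHD hM.le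
  obtain ⟨-, M', a', 𝒟oc, hsub, hconv, -⟩ := captureC2At_atKerrData hε (hcap M hspin) (hvac M) 𝒟 hmax
  obtain ⟨hM', ha'⟩ := hrig M hM 𝒟 hmax M' a' 𝒟oc 2 le_rfl hsub hconv
  unfold Kerr.IsSubextremal at hsub
  rw [ha', hM', abs_of_pos hM] at hsub
  exact lt_irrefl _ hsub

/-- **(B) The massless member is refuted only modulo `C²` Kerr-limit rigidity.** Every member whose
mass predicate admits `M = 0` and whose threshold set reaches some `a₁ ≥ 0` is FALSE modulo
Choquet-Bruhat–Geroch ALONE on the existence side (the constraints of the flat punctured datum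
`Kerr.data 0 0 0` are the tree theorem `Kerr.data_isVacuumConstraintSolution_zero`) and Kerr-limit
rigidity in `C²` at that datum (`KerrLimitRigidity 2 0 _ 0`: no MGHD of the flat datum
`C²`-converges to a sub-extremal Kerr exterior, all of which have `M' > 0` and nonzero curvature):
the member predicts such a limit with `M' ≤ η`. [folklore] -/
theorem captureC2Family_false_of_mass_zero_of_rigidity [Kerr.Facts] [Kerr.SliceFacts] {T : Set ℝ}
    {P : ℝ → Prop} (hT : ∃ a₁ ∈ T, 0 ≤ a₁) (hP : P 0)
    (hMGHD : choquetBruhat_geroch_exists_mghd_cauchy)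
    (hrig : Negative.KerrLimitRigidity 2 0 le_rfl 0) : ¬ CaptureC2Family T P := by
  intro h
  obtain ⟨a₁, ha₁T, ha₁⟩ := hT
  obtain ⟨s, δ, hsδ⟩ := h a₁ ha₁T
  obtain ⟨ε, hε, hcap⟩ := hsδ 0 le_rfl hP 1 one_pos
  have hspin : |(0 : ℝ)| ≤ a₁ * 0 := by simp
  obtain ⟨𝒟, hmax⟩ :=
    exists_mghd (Kerr.data_isVacuumConstraintSolution_zero 0 0) hMGHD le_rfl
  obtain ⟨-, M', a', 𝒟oc, hsub, hconv, -⟩ :=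
    captureC2At_atKerrData hε (hcap 0 hspin) (Kerr.data_isVacuumConstraintSolution_zero 0 0) 𝒟 hmax
  obtain ⟨hM', ha'⟩ := hrig 𝒟 hmax M' a' 𝒟oc 2 le_rfl hsub hconv
  unfold Kerr.IsSubextremal at hsub
  rw [ha', hM', abs_zero] at hsub
  exact lt_irrefl _ hsub

/-- **Summary of §5.** Granted Choquet-Bruhat–Geroch, the Kerr-data constraints and `C²`
Kerr-limit rigidity at the extremal and flat centres, both one-hypothesis weakenings of the crux —
closed spin range `a₁ ≤ 1`, non-negative mass `0 ≤ M` — are false, while the crux implies every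
member below it: any proof of `BulkKerrCaptureC2` must use the strict gap `a₁ < 1` and `0 < M`.
[folklore] -/
theorem strengthenings_fail_of_rigidity [Kerr.Facts] [Kerr.SliceFacts]
    (hvac : ∀ M a : ℝ, Kerr.data_isVacuumConstraintSolution M a M)
    (hMGHD : choquetBruhat_geroch_exists_mghd_cauchy)
    (hrig₁ : ∀ (M : ℝ) (hM : 0 < M), Negative.KerrLimitRigidity 2 M hM.le M)
    (hrig₀ : Negative.KerrLimitRigidity 2 0 le_rfl 0) :
    ¬ CaptureC2Family (Iic 1) (0 < ·) ∧ ¬ CaptureC2Family (Iio 1) (0 ≤ ·) :=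
  ⟨captureC2Family_false_of_one_le_of_rigidity ⟨1, self_mem_Iic, le_rfl⟩ ⟨1, one_pos, one_pos⟩
      (fun M ↦ hvac M M) hMGHD hrig₁,
    captureC2Family_false_of_mass_zero_of_rigidity ⟨0, by norm_num, le_rfl⟩ le_rfl hMGHD hrig₀⟩

/-! ## §6 Kill templates: the honest shape of a refutation of the crux -/

/-- **Kill template (general centre).** ONE maximal vacuum Cauchy development of ONE exact
sub-extremal Kerr datum `Kerr.data M a M` (`0 < M`, `|a| < M`) which is not far-complete, or which
for some tolerance `η > 0` has no region `C²`-converging to any `η`-close sub-extremal Kerr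
exterior, refutes the crux outright (threshold `a₁ := |a|/M`). The constraints of the datum enter
as `hvac`. Such a development is not expected to exist (Hintz, arXiv:2606.28253, Thm. 13.1 claims
the opposite on the whole sub-extremal range) and none is constructible here (Choquet-Bruhat–Geroch
is a named fact). [folklore] -/
theorem not_bulkKerrCaptureC2_of_kerrData_mghd [Kerr.Facts] [Kerr.SliceFacts] {M a : ℝ}
    (hM : 0 < M) (ha : Kerr.IsSubextremal M a)
    (hvac : ∀ M a r₀ : ℝ, Kerr.data_isVacuumConstraintSolution M a r₀)
    (𝒟 : VacuumCauchyDevelopment (Kerr.data M a M hM.le)) (hmax : 𝒟.IsMaximal)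
    (hbad : ¬ 𝒟.HasCompleteFutureNullInfinityFar ∨
      ∃ η > (0 : ℝ), ∀ (M' a' : ℝ) (𝒟oc : Set 𝒟.carrier), Kerr.IsSubextremal M' a' →
        𝒟.toSpacetime.ConvergesToKerr 𝒟oc M' a' 2 → η < |M' - M| + |a' - a|) :
    ¬ BulkKerrCaptureC2 := by
  intro h
  obtain ⟨hfar, hcap⟩ := bulkKerrCaptureC2_atKerrData h hvac hM ha 𝒟 hmax
  rcases hbad with hnot | ⟨η, hη, hno⟩
  · exact hnot hfar
  · obtain ⟨M', a', 𝒟oc, hsub, hconv, hpar⟩ := hcap η hη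
    exact (hno M' a' 𝒟oc hsub hconv).not_ge hpar

/-- **Kill template (Schwarzschild centre), no named-fact hypothesis**: one bad MGHD of the
Schwarzschild datum on `{t* = 0, r > M}` refutes the crux (constraints are the tree theorem
`Kerr.data_isVacuumConstraintSolution_zero`). Refuting the crux this way means exhibiting a
maximal development of exact Schwarzschild data that does NOT settle to any nearby slowly
rotating Kerr in `C²` — the negation of the refereed Klainerman–Szeftel / DHRT theorems in the
tree's consequence form. [folklore] -/
theorem not_bulkKerrCaptureC2_of_schwarzschild_mghd [Kerr.Facts] [Kerr.SliceFacts] {M : ℝ}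
    (hM : 0 < M) (𝒟 : VacuumCauchyDevelopment (Kerr.data M 0 M hM.le)) (hmax : 𝒟.IsMaximal)
    (hbad : ¬ 𝒟.HasCompleteFutureNullInfinityFar ∨
      ∃ η > (0 : ℝ), ∀ (M' a' : ℝ) (𝒟oc : Set 𝒟.carrier), Kerr.IsSubextremal M' a' →
        𝒟.toSpacetime.ConvergesToKerr 𝒟oc M' a' 2 → η < |M' - M| + |a' - 0|) :
    ¬ BulkKerrCaptureC2 := by
  intro h
  obtain ⟨hfar, hcap⟩ := bulkKerrCaptureC2_atSchwarzschildData h hM 𝒟 hmax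
  rcases hbad with hnot | ⟨η, hη, hno⟩
  · exact hnot hfar
  · obtain ⟨M', a', 𝒟oc, hsub, hconv, hpar⟩ := hcap η hη
    exact (hno M' a' 𝒟oc hsub hconv).not_ge hpar

/-- **What a disproof must show.** Granted the two instance facts, `¬ BulkKerrCaptureC2` iff for
SOME threshold `a₁ ∈ [0, 1)` and EVERY `(s, δ)` there are a mass `M > 0` and a tolerance `η > 0`
such that EVERY basin `ε > 0` contains a bad spin: b-conormal, `ε`-close vacuum data with a maximal
development violating the `C²`-capture conclusion. A kill must therefore defeat every Sobolev order
and every decay weight at once. [folklore] -/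
theorem not_bulkKerrCaptureC2_iff [hF : Kerr.Facts] [hS : Kerr.SliceFacts] :
    ¬ BulkKerrCaptureC2 ↔
      ∃ a₁ : ℝ, 0 ≤ a₁ ∧ a₁ < 1 ∧ ∀ (s : ℕ) (δ : ℝ), ∃ (M : ℝ) (hM : 0 < M), ∃ η > (0 : ℝ),
        ∀ ε > (0 : ℝ), ∃ a : ℝ, |a| ≤ a₁ * M ∧ ¬ CaptureC2At s δ M hM.le ε η a := by
  rw [bulkKerrCaptureC2_iff_nonneg]
  constructor
  · intro h
    by_contra hcon
    push Not at hcon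
    exact h fun {_ _} a₁ h0 ha₁ ↦ by
      obtain ⟨s, δ, hsδ⟩ := hcon a₁ h0 ha₁
      exact ⟨s, δ, fun M hM η hη ↦ by
        obtain ⟨ε, hε, hcap⟩ := hsδ M hM η hη
        exact ⟨ε, hε, fun a ha ↦ by
          have := hcap a ha
          convert this⟩⟩
  · rintro ⟨a₁, h0, ha₁, h⟩ h'
    obtain ⟨s, δ, hsδ⟩ := @h' hF hS a₁ h0 ha₁
    obtain ⟨M, hM, η, hη, hbad⟩ := h s δ
    obtain ⟨ε, hε, hcap⟩ := hsδ M hM η hη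
    obtain ⟨a, ha, hna⟩ := hbad ε hε
    exact hna (hcap a ha)


/-- **The crux implies the pointwise `k = 2` claim shape at the unit leaf.** For each `M > 0` and
`|a| < M` separately (threshold `a₁ := |a|/M`), `BulkKerrCaptureC2` yields `(s, δ)` and, per
tolerance, a basin — verbatim the conclusion of
`Literature.Geometry.Lorentzian.hintz_kerr_stability_subextremal_cauchy_allOrders.orderTwo` at
`r₀ = M`. So the crux sits between Hintz's all-orders claim at `ρ₀ = 1` (locally uniform in the
spin; the landed port `Theorems.bulkKerrCaptureC2_of_allOrdersBody`) and its pointwise `k = 2`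
instance: its only content beyond the latter is LOCAL UNIFORMITY of `(s, δ, ε)` in `a` (Hintz's
Remark 13.2) — a disproof that grants the pointwise theorem must break that uniformity. [folklore] -/
theorem bulkKerrCaptureC2_pointwise (h : BulkKerrCaptureC2) [Kerr.Facts] [Kerr.SliceFacts]
    {M a : ℝ} (hM : 0 < M) (ha : Kerr.IsSubextremal M a) :
    ∃ (s : ℕ) (δ : ℝ), ∀ η > (0 : ℝ), ∃ ε > (0 : ℝ),
      ∀ (D : InitialDataSet 𝓘(ℝ, E3) (Kerr.slice a M)) [D.metric.HasLeviCivita],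
        D.IsVacuumConstraintSolution →
        (∀ s' : ℕ,
          InitialDataSet.dataWeightedSobolevEDist s' δ D (Kerr.data M a M hM.le) < ⊤) →
        InitialDataSet.dataWeightedSobolevEDist s δ D (Kerr.data M a M hM.le) <
          ENNReal.ofReal ε →
        ∀ 𝒟 : VacuumCauchyDevelopment D, 𝒟.IsMaximal →
          ∃ (M' a' : ℝ) (𝒟oc : Set 𝒟.carrier), Kerr.IsSubextremal M' a' ∧
            |M' - M| + |a' - a| ≤ η ∧
            𝒟.HasCompleteFutureNullInfinityFar ∧
            𝒟.toSpacetime.ConvergesToKerr 𝒟oc M' a' 2 := by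
  rw [bulkKerrCaptureC2_iff_captureC2At] at h
  have ha₁ : |a| / M < 1 := by
    rw [div_lt_one hM]
    exact ha
  obtain ⟨s, δ, hsδ⟩ := h (|a| / M) ha₁
  have hspin : |a| ≤ |a| / M * M := by rw [div_mul_cancel₀ _ hM.ne']
  refine ⟨s, δ, fun η hη ↦ ?_⟩
  obtain ⟨ε, hε, hcap⟩ := hsδ M hM η hη
  refine ⟨ε, hε, fun D _ hvac hcon hdist 𝒟 hmax ↦ ?_⟩
  obtain ⟨M', a', 𝒟oc, hsub, hfar, hconv, hpar⟩ := hcap a hspin D hvac hcon hdist 𝒟 hmax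
  exact ⟨M', a', 𝒟oc, hsub, hpar, hfar, hconv⟩

end Summit.FinalStateConjecture.FinalStateConjecture.Theorems.BulkKerrCaptureC2.Negative

end
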